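import Summits.CriticalPhenomena.PercolationContinuityZ3.Theorems.Transplant.PlanarSkeletonConcDefs
import Summits.CriticalPhenomena.PercolationContinuityZ3.Theorems.Transplant.HeisenbergKCylSubcritical
import HarnessLib

/-!
# The higher Heisenberg groups `H_{2k+1}(ℤ)` (`k ≥ 2`) carry the design-(D) interface `PlanarSkeletonConc` over one pair `(a_j, b_j)`:
# degree `|S|`, outward steps, and CONNECTED cylinders `{|a_j|, |b_j| ≤ ℓ}` for EVERY `ℓ`; `θ_{H_{2k+1}}(p_c) = 0` from the node of record

builds on p205010 (kernel theorem, internal audit signed; external expert review pending) — nothing in this file uses p205010.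
Status sentence (coordinator 2026-08-20T04:30Z): "θ(p_c) = 0 on ℤ^d, all d ≥ 2 — kernel-verified (Lean 4/Mathlib, standard axioms);
internal adversarial audit SIGNED 2026-08-20 04:29Z; external expert review pending."

Lane `prim-bschramm`, seat `prim-bschramm-p4` (gen 5; class map, memo `P4-GENERAL.md` §13), helper file
(`--supports stmt-CriticalPhenomena-4575`).  Third INSTANCE of `PlanarSkeletonConc` (stmt-g6, `PlanarSkeletonConcDefs.lean`; design of
record SHEAR-SCOPE §p3 / V83), for `Cay(H_{2k+1}(ℤ); A_i^{±1}, B_i^{±1})` (`HeisenbergKGroup.lean`, p4 gen 4) with the skeleton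
`hkSkeleton j` (`φ = (a_j, b_j)`).  Given a SECOND pair `j' ≠ j` (so `k ≥ 2`): (μ) degree `≤ |S|` (`hk_degree_le`), (ι) outward steps by
`A_j^{±1}`, `B_j^{±1}` (`hk_step`), (κ) the cylinder `hkCyl j ℓ = {|a_j| ≤ ℓ, |b_j| ≤ ℓ}` is connected for EVERY `ℓ ≥ 0`
(`hkCylGraph_connected`; pattern of `HeisenbergKSlabConnected.lean`: `A`-segments reach `(a, 0, 0)`, `B`-segments some `(a, b, c₀)` — both
by betweenness in the two constrained coordinates —, and the commutator 4-cycles at the FREE pair `j'`, which never move `(a_j, b_j)`,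
adjust `c`).  Input Φ2 at `p_c` is in the tree (`hkSkeleton_cylSubcritical`, p228798, Martineau–Severo), so the node is the only hypothesis:

* `hkSkeletonConc (hjj : j' ≠ j) : PlanarSkeletonConc (hkGraph k)` (extends `hkSkeleton j`);
* `heisenbergK_criticalContinuity_of_skeletonConcNode (hD : SamePDropOfSkeletonConcLt) (hjj : j' ≠ j) : θ_{H_{2k+1}}(1, p_c) = 0` and the
  every-vertex form `…Node'` for `k ≥ 2`.  Nothing is claimed about the node.
[cite: BenjaminiSchramm1996, Conj. 4; §2 (Cayley graphs)] [cite: KozmaNitzan2024, §4 p. 15 (boxes); §1 p. 2 (approach 1)] [cite: MartineauSevero2019, Cor. 2.2]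
-/

noncomputable section

namespace Summit.CriticalPhenomena.PercolationContinuityZ3.Theorems.Transplant

open MeasureTheory Literature.Probability.Percolation Literature.Probability.LatticeModels SimpleGraph
open Literature.Barriers.CriticalPhenomena (IsQuasiTransitive IsGraphAmenable)

variable {k : ℕ} {j : Fin k} {ℓ : ℕ}

/-! ## §1 The cylinder over the pair `j` -/

/-- The cylinder `{|a_j| ≤ ℓ, |b_j| ≤ ℓ}` of `H_{2k+1}(ℤ)` (all other coordinates and `c` free). [cite: KozmaNitzan2024, §4 p. 15 (boxes)] -/
def hkCyl (j : Fin k) (ℓ : ℕ) : Set (HK k) := {x | |x.1 j| ≤ ℓ ∧ |x.2.1 j| ≤ ℓ}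

/-- The cylinder graph `G[hkCyl j ℓ]`. [folklore] -/
abbrev hkCylGraph (j : Fin k) (ℓ : ℕ) : SimpleGraph (hkCyl j ℓ) := (hkGraph k).induce (hkCyl j ℓ)

/-- Membership in the cylinder, unfolded. [folklore] -/
theorem mem_hkCyl_iff {x : HK k} : x ∈ hkCyl j ℓ ↔ |x.1 j| ≤ ℓ ∧ |x.2.1 j| ≤ ℓ := Iff.rfl

/-- Membership of a coordinate triple in the cylinder. [folklore] -/
theorem mk_mem_hkCyl_iff {a b : Fin k → ℤ} {c : ℤ} : ((a, b, c) : HK k) ∈ hkCyl j ℓ ↔ |a j| ≤ ℓ ∧ |b j| ≤ ℓ := Iff.rfl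

/-- `1 ∈ hkCyl j ℓ`. [folklore] -/
theorem zero_mem_hkCyl (j : Fin k) (ℓ : ℕ) : (0 : HK k) ∈ hkCyl j ℓ := by simp [mem_hkCyl_iff]

/-- The base point of the cylinder graph. [folklore] -/
abbrev hkCylOrigin (j : Fin k) (ℓ : ℕ) : hkCyl j ℓ := ⟨0, zero_mem_hkCyl j ℓ⟩

/-- The skeleton's cylinders at `1` are the `hkCyl j ℓ`. [folklore] -/
theorem hkSkeleton_cyl_eq (j : Fin k) (ℓ : ℕ) : (hkSkeleton j).cyl 0 ℓ = hkCyl j ℓ :=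
  Set.ext fun w => mem_hkSkeleton_cyl j ℓ w

/-- A generator step that stays in the cylinder is an edge of the cylinder graph. [folklore] -/
theorem hkCyl_step {u : HK k} (hu : u ∈ hkCyl j ℓ) {s : HK k} (hs : s ∈ hkGens k) (hv : hkMul u s ∈ hkCyl j ℓ) :
    (hkCylGraph j ℓ).Reachable ⟨u, hu⟩ ⟨hkMul u s, hv⟩ := by
  refine SimpleGraph.Adj.reachable ?_
  rw [SimpleGraph.comap_adj, Function.Embedding.coe_subtype]
  exact hkGraph_adj_mul_gen u hs

/-- Transport of a reachability target along an equality of vertices. [folklore] -/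
theorem hkCyl_reach_of_eq {x : hkCyl j ℓ} {v v' : HK k} {hv : v ∈ hkCyl j ℓ} (h : v = v')
    (hr : (hkCylGraph j ℓ).Reachable x ⟨v, hv⟩) : (hkCylGraph j ℓ).Reachable x ⟨v', h ▸ hv⟩ := by
  subst h; exact hr

/-! ## §2 Segments inside the cylinder (betweenness in the two constrained coordinates) -/

/-- Betweenness for `A`-segments: if `u, u A_i^t ∈ Cyl` then `u A_i^{t'} ∈ Cyl` for `t'` between `0` and `t`. [folklore] -/
theorem mem_hkCyl_between_a {u : HK k} (hu : u ∈ hkCyl j ℓ) (i : Fin k) {t t' : ℤ}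
    (hbt : (0 ≤ t' ∧ t' ≤ t) ∨ (t ≤ t' ∧ t' ≤ 0)) (ht : hkMul u (aPow i t) ∈ hkCyl j ℓ) : hkMul u (aPow i t') ∈ hkCyl j ℓ := by
  rw [mem_hkCyl_iff, hkMul_aPow] at ht ⊢
  have h0 : |u.1 j| ≤ ℓ := (mem_hkCyl_iff.1 hu).1
  refine ⟨?_, ht.2⟩
  have ht1 := ht.1
  simp only [Pi.add_apply, Pi.single_apply] at ht1 ⊢
  by_cases hji : j = i
  · rw [if_pos hji] at ht1 ⊢
    rw [abs_le] at h0 ht1 ⊢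
    rcases hbt with ⟨h2, h3⟩ | ⟨h2, h3⟩ <;> constructor <;> linarith [h0.1, h0.2]
  · rw [if_neg hji] at ht1 ⊢; exact ht1

/-- Betweenness for `B`-segments: if `u, u B_i^t ∈ Cyl` then `u B_i^{t'} ∈ Cyl` for `t'` between `0` and `t`. [folklore] -/
theorem mem_hkCyl_between_b {u : HK k} (hu : u ∈ hkCyl j ℓ) (i : Fin k) {t t' : ℤ}
    (hbt : (0 ≤ t' ∧ t' ≤ t) ∨ (t ≤ t' ∧ t' ≤ 0)) (ht : hkMul u (bPow i t) ∈ hkCyl j ℓ) : hkMul u (bPow i t') ∈ hkCyl j ℓ := by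
  rw [mem_hkCyl_iff, hkMul_bPow] at ht ⊢
  have h0 : |u.2.1 j| ≤ ℓ := (mem_hkCyl_iff.1 hu).2
  refine ⟨ht.1, ?_⟩
  have ht2 := ht.2
  simp only [Pi.add_apply, Pi.single_apply] at ht2 ⊢
  by_cases hji : j = i
  · rw [if_pos hji] at ht2 ⊢
    rw [abs_le] at h0 ht2 ⊢
    rcases hbt with ⟨h2, h3⟩ | ⟨h2, h3⟩ <;> constructor <;> linarith [h0.1, h0.2]
  · rw [if_neg hji] at ht2 ⊢; exact ht2

/-- **`A`-segments** inside the cylinder. [folklore] -/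
theorem hkCyl_reach_aPow (u : HK k) (hu : u ∈ hkCyl j ℓ) (i : Fin k) :
    ∀ (t : ℤ) (ht : hkMul u (aPow i t) ∈ hkCyl j ℓ), (hkCylGraph j ℓ).Reachable ⟨u, hu⟩ ⟨hkMul u (aPow i t), ht⟩ := by
  intro t
  induction t using Int.induction_on with
  | zero =>
    intro ht
    exact hkCyl_reach_of_eq (by rw [aPow_zero, hkMul_zero]) (Reachable.refl _)
  | succ n ih =>
    intro ht
    have hn : hkMul u (aPow i (n : ℤ)) ∈ hkCyl j ℓ := mem_hkCyl_between_a hu i (Or.inl ⟨by positivity, by linarith⟩) ht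
    have e : hkMul (hkMul u (aPow i (n : ℤ))) (aPow i 1) = hkMul u (aPow i ((n : ℤ) + 1)) := by rw [hkMul_assoc, aPow_mul]
    exact (ih hn).trans (hkCyl_reach_of_eq e (hkCyl_step hn (aPow_mem_hkGens i (Or.inl rfl)) (e ▸ ht)))
  | pred n ih =>
    intro ht
    have hn : hkMul u (aPow i (-(n : ℤ))) ∈ hkCyl j ℓ := mem_hkCyl_between_a hu i (Or.inr ⟨by linarith, by simp⟩) ht
    have e : hkMul (hkMul u (aPow i (-(n : ℤ)))) (aPow i (-1)) = hkMul u (aPow i (-(n : ℤ) - 1)) := by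
      rw [hkMul_assoc, aPow_mul, sub_eq_add_neg]
    exact (ih hn).trans (hkCyl_reach_of_eq e (hkCyl_step hn (aPow_mem_hkGens i (Or.inr rfl)) (e ▸ ht)))

/-- **`B`-segments** inside the cylinder. [folklore] -/
theorem hkCyl_reach_bPow (u : HK k) (hu : u ∈ hkCyl j ℓ) (i : Fin k) :
    ∀ (t : ℤ) (ht : hkMul u (bPow i t) ∈ hkCyl j ℓ), (hkCylGraph j ℓ).Reachable ⟨u, hu⟩ ⟨hkMul u (bPow i t), ht⟩ := by
  intro t
  induction t using Int.induction_on with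
  | zero =>
    intro ht
    exact hkCyl_reach_of_eq (by rw [bPow_zero, hkMul_zero]) (Reachable.refl _)
  | succ n ih =>
    intro ht
    have hn : hkMul u (bPow i (n : ℤ)) ∈ hkCyl j ℓ := mem_hkCyl_between_b hu i (Or.inl ⟨by positivity, by linarith⟩) ht
    have e : hkMul (hkMul u (bPow i (n : ℤ))) (bPow i 1) = hkMul u (bPow i ((n : ℤ) + 1)) := by rw [hkMul_assoc, bPow_mul]
    exact (ih hn).trans (hkCyl_reach_of_eq e (hkCyl_step hn (bPow_mem_hkGens i (Or.inl rfl)) (e ▸ ht)))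
  | pred n ih =>
    intro ht
    have hn : hkMul u (bPow i (-(n : ℤ))) ∈ hkCyl j ℓ := mem_hkCyl_between_b hu i (Or.inr ⟨by linarith, by simp⟩) ht
    have e : hkMul (hkMul u (bPow i (-(n : ℤ)))) (bPow i (-1)) = hkMul u (bPow i (-(n : ℤ) - 1)) := by
      rw [hkMul_assoc, bPow_mul, sub_eq_add_neg]
    exact (ih hn).trans (hkCyl_reach_of_eq e (hkCyl_step hn (bPow_mem_hkGens i (Or.inr rfl)) (e ▸ ht)))

/-- **`(a, 0, 0)` is reachable from `1` inside the cylinder whenever `|a_j| ≤ ℓ`** (one coordinate at a time). [folklore] -/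
theorem hkCyl_reach_a (S : Finset (Fin k)) : ∀ a : Fin k → ℤ, (∀ i, i ∉ S → a i = 0) → ∀ (ha : ((a, 0, 0) : HK k) ∈ hkCyl j ℓ),
    (hkCylGraph j ℓ).Reachable (hkCylOrigin j ℓ) ⟨(a, 0, 0), ha⟩ := by
  classical
  induction S using Finset.induction_on with
  | empty =>
    intro a hS ha
    have : a = 0 := funext fun i => hS i (Finset.notMem_empty i)
    subst this
    exact hkCyl_reach_of_eq (by rfl) (Reachable.refl _)
  | insert i S hi ih =>
    intro a hS ha
    have ha' : ((Function.update a i 0, 0, 0) : HK k) ∈ hkCyl j ℓ := by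
      rw [mk_mem_hkCyl_iff] at ha ⊢
      refine ⟨?_, ha.2⟩
      by_cases hji : j = i
      · rw [hji, Function.update_self]; simp
      · rw [Function.update_of_ne hji]; exact ha.1
    have r := ih (Function.update a i 0) (fun l hl => by
      by_cases hli : l = i
      · subst hli; simp
      · rw [Function.update_of_ne hli]; exact hS l (by simp [hli, hl])) ha'
    have e : hkMul ((Function.update a i 0, 0, 0) : HK k) (aPow i (a i)) = (a, 0, 0) := by
      rw [hkMul_aPow]
      refine Prod.ext (funext fun l => ?_) rfl
      simp only [Pi.add_apply, Pi.single_apply]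
      by_cases hli : l = i
      · subst hli; simp
      · rw [if_neg hli, add_zero, Function.update_of_ne hli]
    have hmem : hkMul ((Function.update a i 0, 0, 0) : HK k) (aPow i (a i)) ∈ hkCyl j ℓ := by rw [e]; exact ha
    exact hkCyl_reach_of_eq e (r.trans (hkCyl_reach_aPow _ ha' i (a i) hmem))

/-- **Some `(a, b, c₀)` is reachable from `(a, 0, 0)` inside the cylinder whenever `|a_j|, |b_j| ≤ ℓ`.** [folklore] -/
theorem hkCyl_reach_b (a : Fin k → ℤ) (ha : ((a, 0, 0) : HK k) ∈ hkCyl j ℓ) (S : Finset (Fin k)) :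
    ∀ b : Fin k → ℤ, (∀ i, i ∉ S → b i = 0) → |b j| ≤ ℓ →
      ∃ (c : ℤ) (hc : ((a, b, c) : HK k) ∈ hkCyl j ℓ), (hkCylGraph j ℓ).Reachable ⟨(a, 0, 0), ha⟩ ⟨(a, b, c), hc⟩ := by
  classical
  induction S using Finset.induction_on with
  | empty =>
    intro b hS _
    have : b = 0 := funext fun i => hS i (Finset.notMem_empty i)
    subst this
    exact ⟨0, ha, Reachable.refl _⟩
  | insert i S hi ih =>
    intro b hS hb
    have hb' : |Function.update b i 0 j| ≤ ℓ := by
      by_cases hji : j = i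
      · rw [hji, Function.update_self]; simp
      · rw [Function.update_of_ne hji]; exact hb
    obtain ⟨c', hc', r⟩ := ih (Function.update b i 0) (fun l hl => by
      by_cases hli : l = i
      · subst hli; simp
      · rw [Function.update_of_ne hli]; exact hS l (by simp [hli, hl])) hb'
    have e : hkMul ((a, Function.update b i 0, c') : HK k) (bPow i (b i)) = (a, b, c' + a i * b i) := by
      rw [hkMul_bPow]
      refine Prod.ext rfl (Prod.ext (funext fun l => ?_) rfl)
      simp only [Pi.add_apply, Pi.single_apply]
      by_cases hli : l = i
      · subst hli; simp
      · rw [if_neg hli, add_zero, Function.update_of_ne hli]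
    have hc : ((a, b, c' + a i * b i) : HK k) ∈ hkCyl j ℓ := by
      rw [mk_mem_hkCyl_iff] at ha ⊢; exact ⟨ha.1, hb⟩
    have hmem : hkMul ((a, Function.update b i 0, c') : HK k) (bPow i (b i)) ∈ hkCyl j ℓ := by rw [e]; exact hc
    exact ⟨c' + a i * b i, hc, hkCyl_reach_of_eq e (r.trans (hkCyl_reach_bPow _ hc' i (b i) hmem))⟩

/-! ## §3 Commutator cycles at a free pair `j' ≠ j` adjust `c` without moving `(a_j, b_j)` -/

section Free

variable {j' : Fin k} (hjj : j' ≠ j)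
include hjj

/-- `A_{j'}`-steps never leave the cylinder over the pair `j` (`j' ≠ j`). [folklore] -/
theorem hkMul_aPow_mem_hkCyl {u : HK k} (hu : u ∈ hkCyl j ℓ) (t : ℤ) : hkMul u (aPow j' t) ∈ hkCyl j ℓ := by
  rw [mem_hkCyl_iff, hkMul_aPow]
  simp only [Pi.add_apply, Pi.single_eq_of_ne hjj.symm, add_zero]
  exact hu

/-- `B_{j'}`-steps never leave the cylinder over the pair `j` (`j' ≠ j`). [folklore] -/
theorem hkMul_bPow_mem_hkCyl {u : HK k} (hu : u ∈ hkCyl j ℓ) (t : ℤ) : hkMul u (bPow j' t) ∈ hkCyl j ℓ := by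
  rw [mem_hkCyl_iff, hkMul_bPow]
  simp only [Pi.add_apply, Pi.single_eq_of_ne hjj.symm, add_zero]
  exact hu

/-- **`c ↦ c + 1`**: the cycle `A_{j'} B_{j'} A_{j'}⁻¹ B_{j'}⁻¹` from `(a,b,c)` ends at `(a,b,c+1)`, inside the cylinder. [folklore] -/
theorem hkCyl_reach_c_succ (a b : Fin k → ℤ) (c : ℤ) (hx : ((a, b, c) : HK k) ∈ hkCyl j ℓ) :
    (hkCylGraph j ℓ).Reachable ⟨(a, b, c), hx⟩ ⟨(a, b, c + 1), hx⟩ := by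
  have m1 := hkMul_aPow_mem_hkCyl hjj hx 1
  have m2 := hkMul_bPow_mem_hkCyl hjj m1 1
  have m3 := hkMul_aPow_mem_hkCyl hjj m2 (-1)
  have m4 := hkMul_bPow_mem_hkCyl hjj m3 (-1)
  have e : hkMul (hkMul (hkMul (hkMul ((a, b, c) : HK k) (aPow j' 1)) (bPow j' 1)) (aPow j' (-1))) (bPow j' (-1)) = (a, b, c + 1) := by
    simp only [hkMul_aPow, hkMul_bPow, Pi.add_apply, Pi.single_eq_same]
    refine Prod.ext ?_ (Prod.ext ?_ ?_)
    · funext l; simp only [Pi.add_apply, Pi.single_apply]; split_ifs <;> ring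
    · funext l; simp only [Pi.add_apply, Pi.single_apply]; split_ifs <;> ring
    · ring
  exact hkCyl_reach_of_eq e ((((hkCyl_step hx (aPow_mem_hkGens j' (Or.inl rfl)) m1).trans
    (hkCyl_step m1 (bPow_mem_hkGens j' (Or.inl rfl)) m2)).trans (hkCyl_step m2 (aPow_mem_hkGens j' (Or.inr rfl)) m3)).trans
    (hkCyl_step m3 (bPow_mem_hkGens j' (Or.inr rfl)) m4))

/-- **`c ↦ c − 1`**: the cycle `B_{j'} A_{j'} B_{j'}⁻¹ A_{j'}⁻¹`. [folklore] -/
theorem hkCyl_reach_c_pred (a b : Fin k → ℤ) (c : ℤ) (hx : ((a, b, c) : HK k) ∈ hkCyl j ℓ) :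
    (hkCylGraph j ℓ).Reachable ⟨(a, b, c), hx⟩ ⟨(a, b, c - 1), hx⟩ := by
  have m1 := hkMul_bPow_mem_hkCyl hjj hx 1
  have m2 := hkMul_aPow_mem_hkCyl hjj m1 1
  have m3 := hkMul_bPow_mem_hkCyl hjj m2 (-1)
  have m4 := hkMul_aPow_mem_hkCyl hjj m3 (-1)
  have e : hkMul (hkMul (hkMul (hkMul ((a, b, c) : HK k) (bPow j' 1)) (aPow j' 1)) (bPow j' (-1))) (aPow j' (-1)) = (a, b, c - 1) := by
    simp only [hkMul_aPow, hkMul_bPow, Pi.add_apply, Pi.single_eq_same]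
    refine Prod.ext ?_ (Prod.ext ?_ ?_)
    · funext l; simp only [Pi.add_apply, Pi.single_apply]; split_ifs <;> ring
    · funext l; simp only [Pi.add_apply, Pi.single_apply]; split_ifs <;> ring
    · ring
  exact hkCyl_reach_of_eq e ((((hkCyl_step hx (bPow_mem_hkGens j' (Or.inl rfl)) m1).trans
    (hkCyl_step m1 (aPow_mem_hkGens j' (Or.inl rfl)) m2)).trans (hkCyl_step m2 (bPow_mem_hkGens j' (Or.inr rfl)) m3)).trans
    (hkCyl_step m3 (aPow_mem_hkGens j' (Or.inr rfl)) m4))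

/-- **Any two cylinder points over the same `(a, b)` are joined inside the cylinder.** [folklore] -/
theorem hkCyl_reach_c (a b : Fin k → ℤ) (c : ℤ) (hx : ((a, b, c) : HK k) ∈ hkCyl j ℓ) :
    ∀ (d : ℤ) (hd : ((a, b, c + d) : HK k) ∈ hkCyl j ℓ), (hkCylGraph j ℓ).Reachable ⟨(a, b, c), hx⟩ ⟨(a, b, c + d), hd⟩ := by
  have hall : ∀ d : ℤ, ((a, b, c + d) : HK k) ∈ hkCyl j ℓ := fun _ => hx
  intro d
  induction d using Int.induction_on with
  | zero => intro hd; exact hkCyl_reach_of_eq (by simp) (Reachable.refl _)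
  | succ n ih => intro hd; exact (ih (hall _)).trans (hkCyl_reach_of_eq (by ring) (hkCyl_reach_c_succ hjj a b (c + n) (hall _)))
  | pred n ih => intro hd; exact (ih (hall _)).trans (hkCyl_reach_of_eq (by ring) (hkCyl_reach_c_pred hjj a b (c + -n) (hall _)))

/-- **Every cylinder vertex is joined to `1` inside the cylinder.** [folklore] -/
theorem hkCyl_reach_all (x : hkCyl j ℓ) : (hkCylGraph j ℓ).Reachable (hkCylOrigin j ℓ) x := by
  classical
  obtain ⟨⟨a, b, c⟩, hx⟩ := x
  have hx' : |a j| ≤ ℓ ∧ |b j| ≤ ℓ := mk_mem_hkCyl_iff.1 hx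
  have ha : ((a, 0, 0) : HK k) ∈ hkCyl j ℓ := by
    rw [mk_mem_hkCyl_iff]; exact ⟨hx'.1, by simp⟩
  have r1 := hkCyl_reach_a (j := j) (ℓ := ℓ) Finset.univ a (fun i hi => absurd (Finset.mem_univ i) hi) ha
  obtain ⟨c₀, hc₀, r2⟩ := hkCyl_reach_b (j := j) (ℓ := ℓ) a ha Finset.univ b (fun i hi => absurd (Finset.mem_univ i) hi) hx'.2
  have hc : ((a, b, c₀ + (c - c₀)) : HK k) ∈ hkCyl j ℓ := by rw [mk_mem_hkCyl_iff]; exact hx'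
  have r3 := hkCyl_reach_c hjj a b c₀ hc₀ (c - c₀) hc
  exact (r1.trans r2).trans (hkCyl_reach_of_eq (by simp) r3)

/-- **The cylinder graph `G[{|a_j|, |b_j| ≤ ℓ}]` of `Cay(H_{2k+1}(ℤ))` is connected for EVERY `ℓ`** (given a free pair `j' ≠ j`;
interface field (κ) of `PlanarSkeletonConc`, which only asks `ℓ ≥ 1`). [cite: KozmaNitzan2024, §4 p. 15 (boxes)] -/
theorem hkCylGraph_connected : (hkCylGraph j ℓ).Connected :=
  { preconnected := fun x y => (hkCyl_reach_all hjj x).symm.trans (hkCyl_reach_all hjj y)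
    nonempty := ⟨hkCylOrigin j ℓ⟩ }

end Free

/-! ## §4 Degree, outward steps, the instance and the rung -/

/-- **(μ) for `H_{2k+1}(ℤ)`**: every vertex has degree `≤ |S|` (the neighbours are the `x·s`, `s ∈ S`). [folklore] -/
theorem hk_degree_le (v : HK k) : (hkGraph k).degree v ≤ (hkGens k).card := by
  classical
  rw [← card_neighborFinset_eq_degree]
  have h : (hkGraph k).neighborFinset v = (hkGens k).image (hkMul v) := by
    apply Finset.coe_injective
    rw [coe_neighborFinset, neighborSet_hkGraph]
  rw [h]
  exact Finset.card_image_le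

/-- The abelianisation over the pair `j` of the generators `A_j^{±1}`, `B_j^{±1}` is `±e₀`, `±e₁`. [folklore] -/
theorem hkAb_gens (j : Fin k) :
    hkAb j (hkA j : HK k) = Pi.single (0 : Fin 2) (1 : ℤ) ∧ hkAb j (hkAinv j : HK k) = Pi.single (0 : Fin 2) (-1 : ℤ) ∧
      hkAb j (hkB j : HK k) = Pi.single (1 : Fin 2) (1 : ℤ) ∧ hkAb j (hkBinv j : HK k) = Pi.single (1 : Fin 2) (-1 : ℤ) := by
  refine ⟨?_, ?_, ?_, ?_⟩ <;> ext i <;> fin_cases i <;> simp [hkAb, hkA, hkAinv, hkB, hkBinv]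

/-- **(ι) for `H_{2k+1}(ℤ)` over the pair `j`**: `A_j^{±1}`, `B_j^{±1}` move `(a_j, b_j)` by `±e₀`, `±e₁` at every vertex. [folklore] -/
theorem hk_step (j : Fin k) (v : HK k) (i : Fin 2) (σ : ℤˣ) :
    ∃ v' : HK k, (hkGraph k).Adj v v' ∧ hkAb j v' = hkAb j v + Pi.single i (σ : ℤ) := by
  obtain ⟨hA, hAi, hB, hBi⟩ := hkAb_gens j
  rcases Int.units_eq_one_or σ with rfl | rfl <;> fin_cases i
  · exact ⟨hkMul v (hkA j), hkGraph_adj_mul_gen v (hkA_mem j), by rw [hkAb_hkMul, hA]; rfl⟩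
  · exact ⟨hkMul v (hkB j), hkGraph_adj_mul_gen v (hkB_mem j), by rw [hkAb_hkMul, hB]; rfl⟩
  · exact ⟨hkMul v (hkAinv j), hkGraph_adj_mul_gen v (hkAinv_mem j), by rw [hkAb_hkMul, hAi]; rfl⟩
  · exact ⟨hkMul v (hkBinv j), hkGraph_adj_mul_gen v (hkBinv_mem j), by rw [hkAb_hkMul, hBi]; rfl⟩

/-- **`H_{2k+1}(ℤ)` carries the design-(D) interface over the pair `j`** (given a free pair `j' ≠ j`): `hkSkeleton j` + degree `|S|` +
outward steps + connected cylinders (every `ℓ`). [cite: KozmaNitzan2024, §4 p. 15] [cite: BenjaminiSchramm1996, §2] -/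
def hkSkeletonConc {j j' : Fin k} (hjj : j' ≠ j) : PlanarSkeletonConc (hkGraph k) where
  toPlanarSkeleton := hkSkeleton j
  Δ := (hkGens k).card
  degree_le := hk_degree_le
  step := hk_step j
  cyl_connected := by
    intro t ht ℓ _
    have ht' : t = 0 := by simpa using ht
    subst ht'
    have e : {w : HK k | (hkSkeleton j).φ w - (hkSkeleton j).φ 0 ∈ box 2 ℓ} = hkCyl j ℓ := hkSkeleton_cyl_eq j ℓ
    rw [e]
    exact hkCylGraph_connected hjj

/-- The underlying planar skeleton is `hkSkeleton j`. [folklore] -/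
@[simp] theorem hkSkeletonConc_toPlanarSkeleton {j j' : Fin k} (hjj : j' ≠ j) :
    (hkSkeletonConc hjj).toPlanarSkeleton = hkSkeleton j := rfl

/-- **`θ_{H_{2k+1}(ℤ)}(1, p_c) = 0` from the node of record `SamePDropOfSkeletonConcLt`** (NOT proved, never asserted), given two pairs
`j' ≠ j`: connected, quasi-transitive, amenable (Burton–Keane), `p_c < 1`, interface `hkSkeletonConc`, cylinders at `p_c` by the tree's
`hkSkeleton_cylSubcritical`.  Conditional on the node only. [cite: BenjaminiSchramm1996, Conj. 4] [cite: KozmaNitzan2024, §1 p. 2 (approach 1)] -/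
theorem heisenbergK_criticalContinuity_of_skeletonConcNode (hD : SamePDropOfSkeletonConcLt) {j j' : Fin k} (hjj : j' ≠ j) :
    theta (hkGraph k) 0 (criticalProbIOf (hkGraph k) 0) = 0 :=
  continuity_of_skeletonConcLt_drop_amenable hD (hkGraph k) (hkSkeletonConc hjj) (hkGraph_connected hjj) hkGraph_quasiTransitive
    isGraphAmenable_hkGraph 0 (Finset.mem_singleton_self _) (criticalProb_hkGraph_lt_one hjj) (hkSkeleton_cylSubcritical hjj)

/-- **`θ_{H_{2k+1}(ℤ)}(x, p_c) = 0` for every `k ≥ 2` and every vertex `x`, from the node of record alone.** [cite: BenjaminiSchramm1996, Conj. 4] -/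
theorem heisenbergK_criticalContinuity_of_skeletonConcNode' (hD : SamePDropOfSkeletonConcLt) (hk : 2 ≤ k) (x : HK k) :
    theta (hkGraph k) x (criticalProbIOf (hkGraph k) x) = 0 := by
  obtain ⟨j, j', hjj⟩ := exists_two_pairs hk
  have hpc : criticalProbIOf (hkGraph k) x = criticalProbIOf (hkGraph k) 0 := Subtype.ext (criticalProb_hkGraph_eq x)
  rw [hpc, theta_hkGraph_eq]
  exact heisenbergK_criticalContinuity_of_skeletonConcNode hD hjj

/-- The same from the binder-less node `SamePDropOfSkeletonConc` (which implies the node of record). [folklore] -/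
theorem heisenbergK_criticalContinuity_of_skeletonConcNode_of_conc (hD : SamePDropOfSkeletonConc) (hk : 2 ≤ k) (x : HK k) :
    theta (hkGraph k) x (criticalProbIOf (hkGraph k) x) = 0 :=
  heisenbergK_criticalContinuity_of_skeletonConcNode' (samePDropOfSkeletonConcLt_of_conc hD) hk x

end Summit.CriticalPhenomena.PercolationContinuityZ3.Theorems.Transplant

end
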